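import Literature.AlgebraicGeometry.Resolution.LocalEtaleUniformization
import Literature.AlgebraicGeometry.Resolution.HenselianElementsProofs
import Literature.AlgebraicGeometry.Resolution.KrasnerHenselian
import Literature.AlgebraicGeometry.Resolution.HenselizationHenselian
import Literature.AlgebraicGeometry.Resolution.HenselizationImmediateProofs
import Literature.AlgebraicGeometry.Resolution.SeparablyDefectlessDenseDescent
import HarnessLib

/-!
# The dense finite separable step (`stub_denseAlgStep`)

Stub of the birth line of the crux `ShadowsUniformize` (route `AbhyankarShadows`): the LAST
(separable-algebraic) step of the proof of Knaf–Kuhlmann 2009, Prop. 3.11 ("Let `(L|K,P)` be a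
finitely generated, separable extension within the completion of `(K,P)`. Then `P` is strongly
smoothly `O_K`-uniformizable"), arXiv:math/0702856 §3.4:

> Since `L|K(T)` is separable-algebraic and `L` lies in the completion of `K` which is also the
> completion of `K(T)`, `L` must lie within the henselization of `K(T)`. Hence by Lemma 3.7 `P`
> is strongly smoothly `O_{K(T)}`-uniformizable.

Ambient rendering (`ValuedFunctionFields.lean`): one algebraically closed valued field `(Ω, V)`,
subfields `L ≤ F ≤ Ω` with `F | L` finite separable (`FiniteSeparableOver`) and `L` DENSE in `F`
(`IsDenseIn V L F`); conclusion: every finite `Z ⊆ O_F = V ∩ F` is smoothly `O_L`-uniformizable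
(`IsSmoothlyUniformizableIn ↥(V ∩ L) V F Z`).

Proof (all ingredients proved in the tree):
1. `le_henselization_of_isDenseIn`: `F ≤ L^h = henselization V L`. For `y ∈ F`, `y` is
   separable over `L` hence over `L^h ⊇ L`; `L^h` is henselian
   (`Kuhlmann2010HenselizationIsHenselian_holds`) and immediate over `L`
   (`Kuhlmann2010HenselizationImmediate_holds`), so every value `v(e)`, `e ∈ (L^h)^×`, is a value
   `v(b)`, `b ∈ L^× ⊆ F^×`, and density gives `ℓ ∈ L` with `v(y - ℓ) < v(b) = v(e)`; by the
   henselian form of Krasner's lemma (`mem_of_isHenselianField_of_forall_exists_valuation_sub_lt`)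
   `y ∈ L^h`.
2. Kuhlmann–Novacoski 2014, Thm. 1.2 (`KuhlmannNovacoski2014_Thm12_holds`): `F = L(η)` for a
   Hensel root `η ∈ O_F` of a monic `h` over `O_L` with `v(h'(η)) = 0`.
3. Knaf–Kuhlmann 2009, Lemma 3.7 (2) (`isSmoothlyUniformizableIn_of_henselRoot`): the
   standard-étale model `O_L[η][1/μ'(η)]` serves every `Z ⊆ O_F`.
-/

-- single-problem summit: the doubled namespace component is forced
set_option linter.dupNamespace false

namespace Summit.ResolutionOfSingularities.ResolutionOfSingularities.Theorems

open Literature.AlgebraicGeometry.Resolution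

/-- **A separable extension inside the completion lies in the henselization** (Knaf–Kuhlmann
2009, §3.4: "Since `L|K(T)` is separable-algebraic and `L` lies in the completion of `K` …, `L`
must lie within the henselization"). If `L` is dense in `F` and every element of `F` is
separable over `L`, then `F ≤ L^h`: `L^h` is henselian and immediate over `L`, so an element of
`F`, approximable from `L ⊆ L^h` to within every value of `L^× = ` every value of `(L^h)^×`, lies
in `L^h` by Krasner's lemma. [cite: KnafKuhlmann2009, Prop. 3.11] -/
theorem le_henselization_of_isDenseIn {Ω : Type} [Field Ω] [IsAlgClosed Ω]
    (V : ValuationSubring Ω) {L F : Subfield Ω} (hLF : L ≤ F)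
    (hsep : ∀ y ∈ F, IsSeparable L y) (hdense : IsDenseIn V L F) :
    F ≤ henselization V L := by
  intro y hy
  have hLh : IsHenselianField (henselization V L)
      (V.comap (algebraMap (henselization V L) Ω)) :=
    Kuhlmann2010HenselizationIsHenselian_holds Ω V L
  have hsep' : IsSeparable (henselization V L) y :=
    isSeparable_of_subfield_le (le_henselization V L) (hsep y hy)
  refine mem_of_isHenselianField_of_forall_exists_valuation_sub_lt V hLh hsep' ?_
  intro e he he0
  obtain ⟨b, hbL, hb⟩ := (Kuhlmann2010HenselizationImmediate_holds Ω V L).1 e he he0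
  have hb0 : b ≠ 0 := by
    rintro rfl
    rw [map_zero, map_eq_zero] at hb
    exact he0 hb
  obtain ⟨ℓ, hℓL, hℓ⟩ := hdense y hy b (hLF hbL) hb0
  exact ⟨ℓ, le_henselization V L hℓL, hb ▸ hℓ⟩

/-- **The dense finite separable step** (Knaf–Kuhlmann 2009, Prop. 3.11, last paragraph, with
Lemma 3.7 (2)): for subfields `L ≤ F` of the algebraically closed valued field `(Ω, V)` with
`F | L` finite separable and `L` dense in `F`, every finite `Z ⊆ O_F` is smoothly
`O_L`-uniformizable. `F` lies in the henselization `L^h` (`le_henselization_of_isDenseIn`), so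
by Kuhlmann–Novacoski 2014, Thm. 1.2, `F = L(η)` for a Hensel root `η ∈ O_F` over `O_L`, and
Lemma 3.7 (2) (`isSmoothlyUniformizableIn_of_henselRoot`) concludes.
[cite: KnafKuhlmann2009, Prop. 3.11 and Lemma 3.7] -/
theorem stub_denseAlgStep {Ω : Type} [Field Ω] [IsAlgClosed Ω] (V : ValuationSubring Ω)
    (L F : Subfield Ω) (hLF : L ≤ F) (hfin : FiniteSeparableOver L F) (hdense : IsDenseIn V L F)
    (Z : Finset Ω) (hZ : ∀ w ∈ Z, w ∈ V ∧ w ∈ F) :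
    IsSmoothlyUniformizableIn ↥(V.toSubring ⊓ L.toSubring) V F (Z : Set Ω) := by
  have hFh : F ≤ henselization V L :=
    le_henselization_of_isDenseIn V hLF (fun y hy => hfin.isSeparable hy) hdense
  obtain ⟨η, -, hηV, hgen, h, hmon, hcoeff, hev, hder⟩ :=
    KuhlmannNovacoski2014_Thm12.exists_henselRoot KuhlmannNovacoski2014_Thm12_holds Ω V L F hLF
      hfin.finiteOver hFh
  exact isSmoothlyUniformizableIn_of_henselRoot V L F hηV hgen h hmon hcoeff hev hder (Z : Set Ω)
    fun w hw => hZ w (Finset.mem_coe.mp hw)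

end Summit.ResolutionOfSingularities.ResolutionOfSingularities.Theorems
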